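import Summits.ResolutionOfSingularities.ResolutionOfSingularities.Theorems.FrobeniusClosingSteerHatBaseChangeChart
import Summits.ResolutionOfSingularities.ResolutionOfSingularities.Theorems.FrobeniusClosingSteerBetaHatStageWords
import HarnessLib

/-!
# Crux `Steer` (stmt-ResolutionOfSingularities-16345), chain W4.1 — the β-slot `HatBaseChangeX` (re-cut, RULING 207(a)) DISCHARGED
# at word level: `hatBaseChangeX_of_words`

OURS (campaign `res-hironaka`, rung L ★L-G4, slot W4.1; seat res-L0-w41-stub-4 g7 on res-L0-w41-plan-1 RULINGS 196d/207(a)). Replaces the role of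
no printed item; NOT a statement of the manuscript under review [claim: Hironaka2017, status: under-review]; AI-produced, weaker than expert review.
Theses-free, definition-free. Words: the tree's `IsHatRing` / `IsArithStage` / `IsXChartHat` (`…BetaHatStageWords`, p552756, idea-1's §2♯/§5
VERBATIM).

* `hatBaseChangeX_of_words` — binder for binder the body of the re-cut word `HatBaseChangeX` of the route document
  `Sketch-idea-1-v18-hatleaf.v1810-candidate.lean` 7c1fb4c2e98b2d95 (res-L0-w41-idea-1 g12; tri-2 ONE-HUNK PASS 18:09:41Z): along an x-chart letter
  `S → S₁` of hat rings at a chart point `c`, with the source stage arithmetic and «`Ψ̄ ⊗_ī κ₁` anisotropic» for a form `Ψ` carrying the stage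
  congruence of `f`, there is a hat ring `S′ = S[T]/(m̃)` (`m̃` the `σ`-lift of `minpoly κ c` — NO Hensel lifting), a local `ι : S → S′`, a
  factorisation `φ = φ′ ∘ ι`, a compatible coefficient field `σ′`, with `(ι x, ι y, ι z, ι w) = 𝔪′`, `κ′` algebraic over `S`, `κ′ ≅ κ₁`,
  `IsXChartHat φ′ σ′ σ₁ (ι x) (ι y) (ι z) (ι w) c v₁ z₁ w₁` at the SAME point, now RATIONAL over `S′`, and `IsArithStage S′ (ι x) (ι y) (ι z) (ι w) (ι u) (ι f) d`.
  Assembly of `…HatFiniteEtale` (p550371) + `…HatBaseChangeChart` (p551625); the leaf's `hatBaseChangeX_holds : HatBaseChangeX` is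
  `fun S S₁ … => hatBaseChangeX_of_words …` (same binder order).
The binders `Odd d`, `3 ≤ d`, `IsHatRing S₁`, the radicand relation and `IsArithStage S₁ …` are carried for uniformity with the word and NOT used
(the anisotropy input already encodes the target stage; cf. `…HatConePersistence`).

[cite: Matsumura1987, Thm. 28.3; proof of Thm. 29.1] [folklore]
bears_on: LADDER-RESOLUTION L ★L-G4 W4.1 (crux `Steer`, binder hK4ⁿᶜ, β-slot `HatBaseChangeX`).
-/

noncomputable section

-- `Summit.<S>.<S>.…` duplicates the summit name by design (single-problem summit).
set_option linter.dupNamespace false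

open IsLocalRing Polynomial
open Summit.ResolutionOfSingularities.ResolutionOfSingularities.Theorems.SwitchingDichotomy.BetaPolygon

namespace Summit.ResolutionOfSingularities.ResolutionOfSingularities.Theorems.SwitchingDichotomy.HatBaseChange

/-- **`HatBaseChangeX` (re-cut) at word level.** See the module docstring. -/
theorem hatBaseChangeX_of_words (S S₁ : Type) [CommRing S] [IsLocalRing S] [CharP S 2] [CommRing S₁] [IsLocalRing S₁] [CharP S₁ 2]
    (φ : S →+* S₁) (σ : ResidueField S →+* S) (σ₁ : ResidueField S₁ →+* S₁)
    (x y z w u f : S) (c : ResidueField S₁) (v₁ z₁ w₁ u₁ f₁ : S₁) (d k : ℕ)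
    (hS : IsHatRing S) (_hS₁ : IsHatRing S₁) (_hodd : Odd d) (_h3 : 3 ≤ d)
    (hst : IsArithStage S x y z w u f d) (hX : IsXChartHat φ σ σ₁ x y z w c v₁ z₁ w₁)
    (_hrel : φ (u * f) = φ x ^ (2 * k) * (u₁ * f₁)) (_hst₁ : IsArithStage S₁ (φ x) v₁ z₁ w₁ u₁ f₁ d)
    (hcone : ∃ Ψ : MvPolynomial (Fin 2) S, Ψ.IsHomogeneous d ∧
      f - MvPolynomial.eval ![z, w] Ψ ∈ Ideal.span {x, y} * maximalIdeal S ^ (d - 1) ⊔ maximalIdeal S ^ (d + 1) ∧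
      ∀ a b : ResidueField S₁, (a ≠ 0 ∨ b ≠ 0) →
        MvPolynomial.eval ![a, b] (MvPolynomial.map (((residue S₁).comp (φ.comp σ)).comp (residue S)) Ψ) ≠ 0) :
    ∃ (S' : Type) (_ : CommRing S') (_ : IsLocalRing S') (_ : CharP S' 2)
      (ι : S →+* S') (φ' : S' →+* S₁) (σ' : ResidueField S' →+* S'),
      IsHatRing S' ∧ φ'.comp ι = φ ∧ IsLocalHom ι ∧
      Ideal.span {ι x, ι y, ι z, ι w} = maximalIdeal S' ∧
      (∀ a : ResidueField S, ι (σ a) = σ' (residue S' (ι (σ a)))) ∧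
      (∀ b : ResidueField S', ∃ P : Polynomial S, Polynomial.map ((residue S').comp ι) P ≠ 0 ∧
        (Polynomial.map ((residue S').comp ι) P).eval b = 0) ∧
      Function.Bijective ((residue S₁).comp (φ'.comp σ')) ∧
      IsXChartHat φ' σ' σ₁ (ι x) (ι y) (ι z) (ι w) c v₁ z₁ w₁ ∧
      (∃ c₀ : ResidueField S', residue S₁ (φ' (σ' c₀)) = c) ∧
      IsArithStage S' (ι x) (ι y) (ι z) (ι w) (ι u) (ι f) d := by
  classical
  obtain ⟨hN, hreg, hcomp, hdim, hperf⟩ := hS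
  haveI := hN; haveI := hcomp; haveI := hperf
  obtain ⟨hspan, ⟨a, b, ha, hb, hu⟩, -⟩ := hst
  obtain ⟨hσ, hσ₁, hcompat, hgen, hspan₁, hy, hz, hw⟩ := hX
  obtain ⟨Ψ, hΨ, hcong, han⟩ := hcone
  -- the modulus: the `σ`-lift of the minimal polynomial of the chart point
  letI := ((residue S₁).comp (φ.comp σ)).toAlgebra
  have hint := isIntegral_chartPoint φ σ c hgen
  set m : Polynomial (ResidueField S) := minpoly (ResidueField S) c with hm_def
  have hm : m.Monic := minpoly.monic hint
  have hirr : Irreducible m := minpoly.irreducible hint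
  have hroot : (m.map σ).eval₂ φ (σ₁ c) = 0 := eval₂_map_minpoly_chartPoint φ σ σ₁ c hcompat
  haveI := isLocalRing_adjoinRoot_section σ hσ m hm hirr
  obtain ⟨σ', hsec, hfac, hloc, hspan', hcompat', halg, hbij, hX', hrat⟩ :=
    chart_clauses φ σ σ₁ x y z w c v₁ z₁ w₁ hσ hσ₁ hcompat hgen hspan₁ hy hz hw hspan m hm hirr hroot
  obtain ⟨hN', hreg', hcomp', hdim', hperf'⟩ := hatRing_clauses_adjoinRoot_section σ hσ m hreg hm hirr
  refine ⟨AdjoinRoot (m.map σ), inferInstance, inferInstance, charP_adjoinRoot_section σ m 2 hm hirr.natDegree_pos,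
    AdjoinRoot.of (m.map σ), AdjoinRoot.lift φ (σ₁ c) hroot, σ', ⟨hN', hreg', hcomp', by rw [hdim', hdim], hperf'⟩, hfac, hloc, hspan',
    hcompat', halg, hbij, hX', ⟨_, hrat⟩, hspan', ⟨a, b, ha, hb, by rw [hu, map_mul, map_pow, map_pow]⟩,
    MvPolynomial.map (AdjoinRoot.of (m.map σ)) Ψ, hΨ.map _, ?_, stage_congruence_map σ hσ m hm hirr x y z w f d Ψ hcong⟩
  -- anisotropy over `κ′`, read off `Ψ̄ ⊗_ī κ₁` along `Θ = residue₁ ∘ φ′ ∘ σ′`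
  refine anisotropic_map_of_anisotropic_baseChange σ hσ m hm hirr ((residue S₁).comp (φ.comp σ))
    ((residue S₁).comp ((AdjoinRoot.lift φ (σ₁ c) hroot).comp σ')) hbij (fun s => ?_) Ψ han
  -- `Θ (residue′ (ι s)) = ī (residue s)`: both are `residue₁ (φ s)`
  have hx₁ : φ x ∈ maximalIdeal S₁ := by rw [← hspan₁]; exact Ideal.subset_span (by simp)
  have hgens : ∀ t ∈ ({x, y, z, w} : Set S), φ t ∈ maximalIdeal S₁ := by
    intro t ht
    simp only [Set.mem_insert_iff, Set.mem_singleton_iff] at ht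
    rcases ht with h | h | h | h <;> rw [h]
    · exact hx₁
    · rw [hy]; exact Ideal.mul_mem_right _ _ hx₁
    · rw [hz]; exact Ideal.mul_mem_right _ _ hx₁
    · rw [hw]; exact Ideal.mul_mem_right _ _ hx₁
  have hφm : ∀ t ∈ maximalIdeal S, φ t ∈ maximalIdeal S₁ := by
    intro t ht
    rw [← hspan] at ht
    have hle : (Ideal.span {x, y, z, w}).map φ ≤ maximalIdeal S₁ := by
      rw [Ideal.map_span, Ideal.span_le]
      rintro _ ⟨t', ht', rfl⟩
      exact hgens t' ht'
    exact hle (Ideal.mem_map_of_mem φ ht)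
  have hφ'ι : ∀ t, (AdjoinRoot.lift φ (σ₁ c) hroot) (AdjoinRoot.of (m.map σ) t) = φ t := fun t => AdjoinRoot.lift_of _
  have hφ'm : ∀ t ∈ maximalIdeal (AdjoinRoot (m.map σ)), (AdjoinRoot.lift φ (σ₁ c) hroot) t ∈ maximalIdeal S₁ := by
    intro t ht
    rw [← hspan'] at ht
    have hle : (Ideal.span {AdjoinRoot.of (m.map σ) x, AdjoinRoot.of (m.map σ) y, AdjoinRoot.of (m.map σ) z,
        AdjoinRoot.of (m.map σ) w}).map (AdjoinRoot.lift φ (σ₁ c) hroot) ≤ maximalIdeal S₁ := by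
      rw [Ideal.map_span, Ideal.span_le]
      rintro _ ⟨t', ht', rfl⟩
      simp only [Set.mem_insert_iff, Set.mem_singleton_iff] at ht'
      rcases ht' with h | h | h | h <;> rw [h, SetLike.mem_coe, hφ'ι]
      · exact hgens x (by simp)
      · exact hgens y (by simp)
      · exact hgens z (by simp)
      · exact hgens w (by simp)
    exact hle (Ideal.mem_map_of_mem _ ht)
  -- LHS: `residue₁ (φ′ (σ′ (residue′ (ι s)))) = residue₁ (φ′ (ι s)) = residue₁ (φ s)`
  have hL : residue S₁ ((AdjoinRoot.lift φ (σ₁ c) hroot) (σ' (residue _ (AdjoinRoot.of (m.map σ) s)))) = residue S₁ (φ s) := by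
    rw [← hφ'ι s, ← sub_eq_zero, ← map_sub, ← map_sub, IsLocalRing.residue_eq_zero_iff]
    refine hφ'm _ ?_
    rw [← IsLocalRing.residue_eq_zero_iff, map_sub, hsec, sub_self]
  -- RHS: `residue₁ (φ (σ (residue s))) = residue₁ (φ s)`
  have hR : residue S₁ (φ (σ (residue S s))) = residue S₁ (φ s) := by
    rw [← sub_eq_zero, ← map_sub, ← map_sub, IsLocalRing.residue_eq_zero_iff]
    refine hφm _ ?_
    rw [← IsLocalRing.residue_eq_zero_iff, map_sub, hσ, sub_self]
  change residue S₁ ((AdjoinRoot.lift φ (σ₁ c) hroot) (σ' (residue _ (AdjoinRoot.of (m.map σ) s)))) = residue S₁ (φ (σ (residue S s)))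
  rw [hL, hR]

end Summit.ResolutionOfSingularities.ResolutionOfSingularities.Theorems.SwitchingDichotomy.HatBaseChange

end
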